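import Summits.QuantumFields.YangMills.Theorems.BalabanUVNodesN15KingModelTreeGraphLineSums

/-!
# BalabanUVNodes ∕ N15 — THE KING-MODEL RUNG (PART Ι-g): KING's (3.69)–(3.70) **ITERATED** — the NESTED slice sums of Proposition 3.6's power counting for an
# ARBITRARY ordering of the internal lines: `Σ_{0 ≤ j_{l(1)} ≤ … ≤ j_{l(m)} ≤ b} Π_p (L^{j_{l(p)}}η)^{e_p} ≤ Π_i (1 − L^{−D_i})^{−1}·(L^bη)^{D_m}` whenever every partial
# degree `D_i = e_1 + … + e_i` is POSITIVE — «If l(2) ∈ S^c, we can sum over j_{l(1)} ≤ j_{l(2)}, since D(H₁) > 0 … We continue doing this … The final sum over j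
# is then bounded by C» (Track A, DAG node N15 = NE2; FAN-OUT v1.1 §N15 s3 «KING-MODEL RUNG … NE2's analogue DECIDED in the model»)

HONEST FRAMING.  Count-neutral (cell `pub-ymgap`, seat `pub-ymgap-dag-n15-e` g26; `--supports stmt-QuantumFields-27366 --as helper` = K3⁸
`SpineGivenEndpointR13SepCoPHV`).  TEMPLATE LITERATURE: C. King, *The U(1) Higgs model. I. The continuum limit*, Commun. Math. Phys. **102** (1986) 649–677
[King1986], proof of Proposition 3.6, p. 664.  Part Μ (`…KingModelPowerCountingLetters`) typed ONE step of (3.69)∕(3.70) (`sliceWeight_sum_le`); parts Ι-a–Ι-f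
used it for TREE graphs, where the slice sums of different lines decouple.  For a general graph King sums the slices in the ORDER `j_{l(1)} ≤ j_{l(2)} ≤ … ≤
j_{l(m)}` (3.58), one line at a time, each step legal because the partial degree `D(H_i)` (3.66) of the subgraph shrunk so far is positive; this file types
that iteration as a statement about NESTED geometric slice sums with real exponents — the slice-sum half of the power counting for an arbitrary ordering.
(The graph-combinatorial half — which line is a tree line, which closes a loop, the transfer (3.67), §3.5's renormalised graphs that MAKE the degrees
positive — is NOT typed.)  GENERIC real analysis on King's slice lengths `L^jη`, `η = L^{−K}`; NOT Bałaban's `G(U)`; NOT a node discharge; nothing continuum ∕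
ℝ⁴ ∕ OS ∕ mass-gap ∕ Clay.  0 `sorry`; standard axioms.
THE PRINT.  p. 664 [PDF 16]: *«Combining this factor with the power of L^{j_{l(1)}−k} already present from the propagator on l(1) (and any extra factors η at x and
y), we get altogether the exponent D(H₁). If l(2) ∈ S^c, we can sum over j_{l(1)} ≤ j_{l(2)}, since D(H₁) > 0: Σ_{j=−n}^{j_{l(2)}} (L^{j−k})^{D(H₁)} ≤ C(L^{j_{l(2)}−k})^{D(H₁)}.
(3.69) Graphically, we have shrunk l(1) to a point in H; the remaining vertices are summed with the constraint −n ≤ j_{l(2)} ≤ j_{l(3)} ≤ … ≤ j_{l(m)} ≤ k − 1.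
We continue doing this until S^c is exhausted … (3.70) For γ small enough, D(H_i) − γ > 0 and we continue the process, eventually shrinking H to one point x.
The final sum over j is then bounded by C»*; p. 665: *«Redoing the analysis, we see that the degrees of some subgraphs have been reduced by γ; for γ small
enough, the exponents D(H_i) − γ are still positive, and the bound proceeds as before.»*
WHAT THIS FILE PROVES (namespace `…N15KingModelRung.Curved`; slice lengths `s_j = L^jη = L^j·eps L K`; the exponents are listed FROM THE COARSEST LINE DOWN,
`es = [e_m, …, e_1]`, so that `(e :: es).sum = D_m` and the tail's sums are `D_{m−1}, …, D_1`).
* §1 `nestedSliceSum L K es b` (`= Σ_{j_1 ≤ … ≤ j_m ≤ b} Π_p s_{j_p}^{e_p}`, recursively: `nestedSliceSum (e :: es) b = Σ_{j ≤ b} s_j^e·nestedSliceSum es j`),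
  `PosDegrees es` (EVERY partial degree `D_i > 0`: recursively `0 < (e :: es).sum ∧ PosDegrees es`), `PosDegreesBy δ es` (every `D_i > δ`), `degConst L es`
  (`= Π_i (1 − L^{−D_i})^{−1}`), signs.
* §2 ★ `sliceSum_upTo_le` (ONE step, (3.69) in the slice-length letters: `Σ_{j ≤ b} s_j^D ≤ (1 − L^{−D})^{−1}·s_b^D` for `D > 0`, `b ≤ K`, ⇐ part Μ `sliceWeight_sum_le`);
  ★★★ **`nestedSliceSum_le`** — THE ITERATION: `PosDegrees es`, `b ≤ K` ⇒ `nestedSliceSum L K es b ≤ degConst L es·s_b^{es.sum}` (induction from the top line down: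
  «we can sum over j_{l(1)} ≤ j_{l(2)}, since D(H₁) > 0 … We continue doing this»); ★★ `nestedSliceSum_le_degConst` («The final sum over j is then bounded by C»:
  `≤ degConst L es`, uniformly in `K`, at `b ≤ K`).
* §3 ★ `posDegreesBy_lower` — «the degrees of some subgraphs have been reduced by γ … D(H_i) − γ are still positive»: lowering ONE exponent (at any position) by
  `γ ≥ 0` takes `PosDegreesBy δ` to `PosDegreesBy (δ − γ)` (`posDegreesBy_mono`); `posDegrees_of_posDegreesBy` (`δ ≥ 0`).
HONEST SCOPE.  (a) The slice-sum (analytic) half of pp. 663–664's power counting only; the assignment of the exponents `e_p` to King's lines (`lineDeg` for a line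
reaching a new vertex, `lineExp` for a loop-closing line — parts Ι-c∕Η-b's letters), the transfer (3.67), the degrees' positivity (§3.5, Thm 3.5) and the sum over
orderings (3.58) are NOT typed here.  (b) Generic: any `L ≥ 2`, `K`, real exponents.  Locators: [King1986] (3.58) p.663, (3.66) p.663, (3.67)–(3.70) p.664, p.665.
-/

noncomputable section

namespace Summit.QuantumFields.YangMills.BalabanUVNodes.N15KingModelRung.Curved

open scoped BigOperators
open Finset
open Literature.MathematicalPhysics.QuantumFieldTheory.King1986.ContinuumLimit (eps)

variable (L : ℕ)

/-! ## §1 Nested slice sums, partial degrees -/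

/-- **THE NESTED SLICE SUM** over `j_1 ≤ j_2 ≤ … ≤ j_m ≤ b` of `Π_p (L^{j_p}η)^{e_p}` (`η = L^{−K}`), the exponents listed from the coarsest line `j_m` down:
`nestedSliceSum [] b = 1`, `nestedSliceSum (e :: es) b = Σ_{j ≤ b} (L^jη)^e·nestedSliceSum es j`. [cite: King1986, (3.69)–(3.70) p.664, (3.58) p.663] -/
def nestedSliceSum (K : ℕ) : List ℝ → ℕ → ℝ
  | [], _ => 1
  | e :: es, b => ∑ j ∈ Finset.range (b + 1), ((L : ℝ) ^ j * eps L K) ^ e * nestedSliceSum K es j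

omit L in
/-- **EVERY PARTIAL DEGREE IS POSITIVE** (`D_i = e_1 + … + e_i > 0` for all `i`; with the top-down listing, `D_m = (e :: es).sum` and the tail carries
`D_{m−1}, …, D_1`) — King's «since D(H₁) > 0 … D(H_i) − γ > 0». [cite: King1986, (3.66) p.663, (3.69)–(3.70) p.664] -/
def PosDegrees : List ℝ → Prop
  | [] => True
  | e :: es => 0 < e + es.sum ∧ PosDegrees es

omit L in
/-- every partial degree exceeds `δ` (room for lowering exponents by `γ ≤ δ`, p. 665). [cite: King1986, p.665 («D(H_i) − γ are still positive»)] -/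
def PosDegreesBy (δ : ℝ) : List ℝ → Prop
  | [] => True
  | e :: es => δ < e + es.sum ∧ PosDegreesBy δ es

/-- **THE CONSTANT** `Π_i (1 − L^{−D_i})^{−1}` (one geometric constant per shrinking step). [cite: King1986, (3.69)–(3.70) p.664 («bounded by C»)] -/
def degConst : List ℝ → ℝ
  | [] => 1
  | e :: es => (1 - (L : ℝ) ^ (-(e + es.sum)))⁻¹ * degConst es

omit L in
/-- `PosDegreesBy δ` with `δ ≥ 0` gives `PosDegrees`. [folklore] -/
theorem posDegrees_of_posDegreesBy {δ : ℝ} (hδ : 0 ≤ δ) : ∀ {es : List ℝ}, PosDegreesBy δ es → PosDegrees es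
  | [], _ => trivial
  | _ :: _, h => ⟨hδ.trans_lt h.1, posDegrees_of_posDegreesBy hδ h.2⟩

/-- the nested sum is nonnegative (`L ≥ 1`). [folklore] -/
theorem nestedSliceSum_nonneg (hL : 1 ≤ L) (K : ℕ) : ∀ (es : List ℝ) (b : ℕ), 0 ≤ nestedSliceSum L K es b
  | [], _ => zero_le_one
  | e :: es, b => by
      have hL0 : (0 : ℝ) < L := by exact_mod_cast (show 0 < L by omega)
      unfold nestedSliceSum
      exact sum_nonneg fun j _ => mul_nonneg (Real.rpow_nonneg (by unfold eps; positivity) _) (nestedSliceSum_nonneg hL K es j)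

/-- the constant is at least `1` (hence positive) under positive degrees (`L ≥ 2`). [folklore] -/
theorem one_le_degConst (hL : 2 ≤ L) : ∀ {es : List ℝ}, PosDegrees es → 1 ≤ degConst L es
  | [], _ => le_rfl
  | e :: es, h => by
      obtain ⟨hx0, hx1, -⟩ := sliceBase_lt_one hL h.1
      have h1 : 1 ≤ (1 - (L : ℝ) ^ (-(e + es.sum)))⁻¹ := one_le_inv_iff₀.2 ⟨by linarith, by linarith⟩
      unfold degConst
      nlinarith [one_le_degConst hL h.2]

/-! ## §2 The iteration -/

/-- ★ **ONE STEP, (3.69) IN THE SLICE-LENGTH LETTERS**: for `D > 0`, `L ≥ 2` and `b ≤ K`, `Σ_{j ≤ b} (L^jη)^D ≤ (1 − L^{−D})^{−1}·(L^bη)^D` (part Μ `sliceWeight_sum_le`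
with `x = L^{−D}`, `(L^jη)^D = x^{K−j}`). [cite: King1986, (3.69) p.664] -/
theorem sliceSum_upTo_le (hL : 2 ≤ L) {D : ℝ} (hD : 0 < D) {K b : ℕ} (hb : b ≤ K) :
    ∑ j ∈ Finset.range (b + 1), ((L : ℝ) ^ j * eps L K) ^ D ≤ (1 - (L : ℝ) ^ (-D))⁻¹ * ((L : ℝ) ^ b * eps L K) ^ D := by
  have hL0 : (0 : ℝ) < L := by exact_mod_cast (show 0 < L by omega)
  obtain ⟨hx0, hx1, -⟩ := sliceBase_lt_one hL hD
  have h := sliceWeight_sum_le hx0 hx1 (K' := K) (i₂ := b) hb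
  calc ∑ j ∈ Finset.range (b + 1), ((L : ℝ) ^ j * eps L K) ^ D = ∑ j ∈ Finset.range (b + 1), ((L : ℝ) ^ (-D)) ^ (K - j) :=
        sum_congr rfl fun j hj => by
          rw [slice_rpow_eq L hL0, sliceWeight_eq_rpow (show 0 < L by omega) D (show j ≤ K by have := mem_range.1 hj; omega)]
    _ ≤ (1 - (L : ℝ) ^ (-D))⁻¹ * ((L : ℝ) ^ (-D)) ^ (K - b) := h
    _ = (1 - (L : ℝ) ^ (-D))⁻¹ * ((L : ℝ) ^ b * eps L K) ^ D := by
        rw [slice_rpow_eq L hL0, sliceWeight_eq_rpow (show 0 < L by omega) D hb]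

/-- ★★★ **KING's (3.69)–(3.70) ITERATED**: if every partial degree is positive (`PosDegrees es`), then for `b ≤ K`
`nestedSliceSum L K es b ≤ degConst L es·(L^bη)^{es.sum}` — induction from the top line down: the inner nested sum is at most `degConst·s_j^{D_{m−1}}` (hypothesis
for the tail), the product `s_j^{e_m}·s_j^{D_{m−1}} = s_j^{D_m}`, and `Σ_{j ≤ b} s_j^{D_m} ≤ (1 − L^{−D_m})^{−1}s_b^{D_m}` since `D_m > 0` (§2 one step) — p. 664 *«we can sum
over j_{l(1)} ≤ j_{l(2)}, since D(H₁) > 0 … We continue doing this … we continue the process, eventually shrinking H to one point»*. [cite: King1986, (3.69)–(3.70) p.664] -/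
theorem nestedSliceSum_le (hL : 2 ≤ L) (K : ℕ) : ∀ {es : List ℝ}, PosDegrees es → ∀ {b : ℕ}, b ≤ K →
    nestedSliceSum L K es b ≤ degConst L es * ((L : ℝ) ^ b * eps L K) ^ es.sum
  | [], _, b, _ => by simp [nestedSliceSum, degConst]
  | e :: es, h, b, hb => by
      have hL0 : (0 : ℝ) < L := by exact_mod_cast (show 0 < L by omega)
      have hs : ∀ j : ℕ, 0 < (L : ℝ) ^ j * eps L K := fun j => by unfold eps; positivity
      have hdc : 0 ≤ degConst L es := zero_le_one.trans (one_le_degConst L hL h.2)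
      unfold nestedSliceSum degConst
      rw [List.sum_cons]
      calc ∑ j ∈ Finset.range (b + 1), ((L : ℝ) ^ j * eps L K) ^ e * nestedSliceSum L K es j
          ≤ ∑ j ∈ Finset.range (b + 1), ((L : ℝ) ^ j * eps L K) ^ e * (degConst L es * ((L : ℝ) ^ j * eps L K) ^ es.sum) :=
            sum_le_sum fun j hj => mul_le_mul_of_nonneg_left
              (nestedSliceSum_le hL K h.2 (show j ≤ K by have := mem_range.1 hj; omega)) (Real.rpow_nonneg (hs j).le _)
        _ = degConst L es * ∑ j ∈ Finset.range (b + 1), ((L : ℝ) ^ j * eps L K) ^ (e + es.sum) := by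
            rw [mul_sum]
            refine sum_congr rfl fun j _ => ?_
            rw [Real.rpow_add (hs j)]; ring
        _ ≤ degConst L es * ((1 - (L : ℝ) ^ (-(e + es.sum)))⁻¹ * ((L : ℝ) ^ b * eps L K) ^ (e + es.sum)) :=
            mul_le_mul_of_nonneg_left (sliceSum_upTo_le L hL h.1 hb) hdc
        _ = (1 - (L : ℝ) ^ (-(e + es.sum)))⁻¹ * degConst L es * ((L : ℝ) ^ b * eps L K) ^ (e + es.sum) := by ring

/-- ★★ **«THE FINAL SUM OVER j IS THEN BOUNDED BY C»**: under positive partial degrees, for every `b ≤ K` (in particular `b = K − 1`: all slices `0 ≤ j ≤ k − 1`),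
`nestedSliceSum L K es b ≤ degConst L es` — UNIFORMLY IN `K` (the slice length `L^bη ≤ 1` and the total degree `D_m > 0`). [cite: King1986, (3.70) p.664] -/
theorem nestedSliceSum_le_degConst (hL : 2 ≤ L) (K : ℕ) {es : List ℝ} (h : PosDegrees es) {b : ℕ} (hb : b ≤ K) :
    nestedSliceSum L K es b ≤ degConst L es := by
  have hL0 : (0 : ℝ) < L := by exact_mod_cast (show 0 < L by omega)
  have hL1 : (1 : ℝ) ≤ L := by exact_mod_cast (show 1 ≤ L by omega)
  have hdc : 0 ≤ degConst L es := zero_le_one.trans (one_le_degConst L hL h)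
  refine (nestedSliceSum_le L hL K h hb).trans (mul_le_of_le_one_right hdc ?_)
  rcases es with _ | ⟨e, es⟩
  · simp
  · -- `(L^bη)^{D} ≤ 1` for `L^bη ≤ 1`, `D > 0`
    have hsle : (L : ℝ) ^ b * eps L K ≤ 1 := by
      unfold eps
      rw [← div_eq_mul_inv, div_le_one (by positivity)]
      exact pow_le_pow_right₀ hL1 hb
    have hs0 : 0 ≤ (L : ℝ) ^ b * eps L K := by unfold eps; positivity
    exact Real.rpow_le_one hs0 hsle (by have := h.1; rw [List.sum_cons]; exact this.le)

/-! ## §3 Lowering one exponent by `γ` -/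

omit L in
/-- the total degree after lowering one exponent: `(pre ++ (e − γ) :: post).sum = (pre ++ e :: post).sum − γ`. [folklore] -/
theorem sum_lower (pre post : List ℝ) (e γ : ℝ) : (pre ++ (e - γ) :: post).sum = (pre ++ e :: post).sum - γ := by
  simp only [List.sum_append, List.sum_cons]; ring

omit L in
/-- `PosDegreesBy` is monotone in the margin. [folklore] -/
theorem posDegreesBy_mono {δ δ' : ℝ} (hδ : δ' ≤ δ) : ∀ {es : List ℝ}, PosDegreesBy δ es → PosDegreesBy δ' es
  | [], _ => trivial
  | _ :: _, h => ⟨hδ.trans_lt h.1, posDegreesBy_mono hδ h.2⟩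

omit L in
/-- ★ **«THE DEGREES OF SOME SUBGRAPHS HAVE BEEN REDUCED BY γ … D(H_i) − γ ARE STILL POSITIVE»**: lowering ONE exponent (at any position of the list) by
`γ ≥ 0` takes `PosDegreesBy δ` to `PosDegreesBy (δ − γ)` (the partial degrees containing that line drop by `γ`, the others are unchanged).
[cite: King1986, p.665 (proof of Prop. 3.6)] -/
theorem posDegreesBy_lower {δ γ : ℝ} (hγ0 : 0 ≤ γ) :
    ∀ (pre post : List ℝ) (e : ℝ), PosDegreesBy δ (pre ++ e :: post) → PosDegreesBy (δ - γ) (pre ++ (e - γ) :: post)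
  | [], post, e, h => by
      have h1 : δ < e + post.sum := h.1
      have h2 : PosDegreesBy δ post := h.2
      exact ⟨show δ - γ < (e - γ) + post.sum by linarith, posDegreesBy_mono (by linarith : δ - γ ≤ δ) h2⟩
  | p :: pre, post, e, h => by
      have h1 : δ < p + (pre ++ e :: post).sum := h.1
      have h2 : PosDegreesBy δ (pre ++ e :: post) := h.2
      have h3 : δ - γ < p + (pre ++ (e - γ) :: post).sum := by rw [sum_lower]; linarith
      exact ⟨h3, posDegreesBy_lower hγ0 pre post e h2⟩

end Summit.QuantumFields.YangMills.BalabanUVNodes.N15KingModelRung.Curved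

end
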